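import Summits.ABC.ABC.Theorems.PlatonicClosureCore
import HarnessLib

/-!
# PlatonicClosureCorePowerLift — part 4/6 of the ROUTE-INDEPENDENT node kernel `PlatonicClosureCore` (door J, second layer; lens-1 gen 7)

Source: lens-1 g7 ROUTE-INDEPENDENT landing variant `pkg/PlatonicClosureTheorems.lean` (cell `decomp-abc`; sha256
`f8bb28f6c96ac600…`; = node file `PlatonicClosure.lean` v2.2 with the three `Theses.RootDecompJ/B/G` imports replaced
by seven inline TREE TEXTS §T, writer recipe decomp-abc STATUS l.502; lens `lean check` rc 0 · 0 sorry · axioms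
standard; critic PRE-CLEARED l.513, bridge test `Iff.rfl` ×7 against J rev 3 / B rev 7 / G rev 6 rc 0).

This module: §7 the power lift `pow_transport` (profile `(N,·,N)`), `deloc`, `deloc_iff`, `powCell_nested`,
`powCell_evanescent`.

Landing form: MECHANICAL six-module split of the source (full account in part 1/6 `PlatonicClosureCoreTransport`): namespace
`Summit.ABC.ABC.Theorems.PlatonicClosureCore`, docstrings, imports, `private` copies of landed folklore lemmas; statements and proofs
byte-identical; imports NO route file (route `closes` may cite it by defeq of the §T tree texts).  Proves neither `ABC` nor any item.
-/

set_option linter.dupNamespace false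
-- lint debt, justified: verbatim planner-cleared proofs keep the item texts' binder names (some hypotheses are unused by name).
set_option linter.unusedVariables false

open Literature.NumberTheory.DiophantineGeometry
open UniqueFactorizationMonoid
open Finset

namespace Summit.ABC.ABC.Theorems.PlatonicClosureCore

/-! Private verbatim copies (gate `dedup.landed`: these folklore statements are already landed in the tree, e.g. in the
J-importing chain `Theorems/PlatonicClosure*.lean`; `private` in their home module here) — so that every proof below
stays byte-identical to the source. -/

/-- The members of an abc triple are nonzero and `a < c`, `b < c`. -/
private theorem triple_facts {a b c : ℕ} (ht : IsABCTriple a b c) :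
    a ≠ 0 ∧ b ≠ 0 ∧ c ≠ 0 ∧ a < c ∧ b < c := by
  obtain ⟨ha, hb, habc, _⟩ := ht
  omega

/-- `radical (m * n) ≤ radical m * radical n`. -/
private theorem radical_mul_le (m n : ℕ) : radical (m * n) ≤ radical m * radical n :=
  Nat.le_of_dvd (Nat.mul_pos (Nat.radical_pos _) (Nat.radical_pos _)) radical_mul_dvd

/-- `radical n ≤ n` for `0 < n`. -/
private theorem radical_le_self {n : ℕ} (hn : 0 < n) : radical n ≤ n := Nat.le_of_dvd hn radical_dvd_self

/-- `radical (m * n) ≤ radical m * n` for `0 < n`. -/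
private theorem radical_mul_le_mul_self (m : ℕ) {n : ℕ} (hn : 0 < n) : radical (m * n) ≤ radical m * n :=
  (radical_mul_le m n).trans (Nat.mul_le_mul_left _ (radical_le_self hn))

/-- For a coprime triple, `rad(abc) = rad a · rad b · rad c`. -/
private theorem rad_eq_prod {a b c : ℕ} (ht : IsABCTriple a b c) : rad a b c = radical a * radical b * radical c := by
  obtain ⟨ha, hb, habc, hcop⟩ := ht
  have hac : Nat.Coprime a c := by rw [← habc]; exact Nat.coprime_self_add_right.mpr hcop
  have hbc : Nat.Coprime b c := by rw [← habc]; exact Nat.coprime_add_self_right.mpr hcop.symm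
  rw [rad_def, radical_mul (Nat.coprime_iff_isRelPrime.mp (Nat.Coprime.mul_left hac hbc)),
    radical_mul (Nat.coprime_iff_isRelPrime.mp hcop)]

/-! ## §7  DELOCALISATION of the residual: the power lift (profile `(N, 1, N)`, every `N`)

`(a,b,c) ↦ (aᴺ, cᴺ - aᴺ, cᴺ)`: three rational special points `0, 1, ∞` of `t ↦ tᴺ`; gain one power of `c`.
Hence `ABC ⟺ P_H ∧ P_E ∧ abc|PowCell N` for EVERY `N`, where `PowCell N` = spherical triples with `a` and `c` both
`N`-full (population `≍ B^{2/N}`); the cells are nested in `N` and no triple lies in all of them. -/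

/-- spherical triples whose first and last members are `N`-full. -/
def PowCell (N : ℕ) (a b c : ℕ) : Prop := SphType a b c ∧ Adm N a ∧ Adm N c

/-- `c^(k+1) - a^(k+1) ≤ (k+1) · c^k · (c - a)` for `0 ≤ a ≤ c` in `ℤ`. -/
private theorem pow_sub_pow_le (a c : ℤ) (ha : 0 ≤ a) (hac : a ≤ c) (k : ℕ) :
    c ^ (k + 1) - a ^ (k + 1) ≤ ((k : ℤ) + 1) * c ^ k * (c - a) := by
  induction k with
  | zero => simp
  | succ n ih =>
    have hc : 0 ≤ c := ha.trans hac
    have e : c ^ (n + 1 + 1) - a ^ (n + 1 + 1) = c * (c ^ (n + 1) - a ^ (n + 1)) + a ^ (n + 1) * (c - a) := by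
      ring
    rw [e]
    have h1 : c * (c ^ (n + 1) - a ^ (n + 1)) ≤ c * (((n : ℤ) + 1) * c ^ n * (c - a)) :=
      mul_le_mul_of_nonneg_left ih hc
    have h2 : a ^ (n + 1) * (c - a) ≤ c ^ (n + 1) * (c - a) :=
      mul_le_mul_of_nonneg_right (pow_le_pow_left₀ ha hac _) (by linarith)
    calc _ ≤ c * (((n : ℤ) + 1) * c ^ n * (c - a)) + c ^ (n + 1) * (c - a) := add_le_add h1 h2
      _ = (((n + 1 : ℕ) : ℤ) + 1) * c ^ (n + 1) * (c - a) := by push_cast; ring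

/-- THE POWER LIFT (degree `k+1`): image profile `≥ (k+1, 1, k+1)`, `c^{k+1} = c'`, `rad' ≤ (k+1)·rad·cᵏ`. -/
private theorem pow_transport (k : ℕ) {a b c : ℕ} (ht : IsABCTriple a b c) :
    ∃ a' b' c' : ℕ, IsABCTriple a' b' c' ∧ (Adm (k + 1) a' ∧ Adm (k + 1) c') ∧
      c ^ (k + 1) ≤ 1 * c' ∧ rad a' b' c' ≤ (k + 1) * rad a b c * c ^ k := by
  obtain ⟨ha0, hb0, hc0, hac, hbc⟩ := triple_facts ht
  obtain ⟨ha, hb, habc, hcop⟩ := ht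
  have hN0 : k + 1 ≠ 0 := by omega
  have hlt : a ^ (k + 1) < c ^ (k + 1) := Nat.pow_lt_pow_left hac hN0
  have hcopac : Nat.Coprime a c := by rw [← habc]; exact Nat.coprime_self_add_right.mpr hcop
  refine ⟨a ^ (k + 1), c ^ (k + 1) - a ^ (k + 1), c ^ (k + 1),
    ⟨by positivity, Nat.sub_pos_of_lt hlt, Nat.add_sub_of_le hlt.le, ?_⟩,
    ⟨adm_pow hN0 ha0, adm_pow hN0 hc0⟩, by rw [one_mul], ?_⟩
  · -- coprime
    apply Nat.Coprime.pow_left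
    have h1 : Nat.Coprime a (c ^ (k + 1)) := hcopac.pow_right (k + 1)
    have e : c ^ (k + 1) - a ^ (k + 1) + a ^ k * a = c ^ (k + 1) := by
      rw [← pow_succ]; exact Nat.sub_add_cancel hlt.le
    rw [← e] at h1
    exact (Nat.coprime_add_mul_right_right _ _ _).mp h1
  · -- radical bound
    have hdvd : b ∣ c ^ (k + 1) - a ^ (k + 1) := by
      have := Nat.sub_dvd_pow_sub_pow c a (k + 1)
      rwa [show c - a = b by omega] at this
    obtain ⟨G, hG⟩ := hdvd
    have hG0 : 0 < G := by
      rcases Nat.eq_zero_or_pos G with h | h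
      · rw [h, mul_zero] at hG; exact absurd hG (Nat.sub_pos_of_lt hlt).ne'
      · exact h
    have hGle : G ≤ (k + 1) * c ^ k := by
      have h1 : ((c : ℤ) ^ (k + 1) - a ^ (k + 1)) ≤ ((k : ℤ) + 1) * c ^ k * (c - a) :=
        pow_sub_pow_le a c (by positivity) (by exact_mod_cast hac.le) k
      have h2 : ((c ^ (k + 1) - a ^ (k + 1) : ℕ) : ℤ) = (b : ℤ) * G := by exact_mod_cast hG
      rw [Nat.cast_sub hlt.le] at h2
      push_cast at h2
      rw [h2, show ((c : ℤ) - a) = b by rw [← habc]; push_cast; ring] at h1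
      have h3 : (b : ℤ) * G ≤ (b : ℤ) * (((k : ℤ) + 1) * c ^ k) := by linarith
      have h4 : (G : ℤ) ≤ ((k : ℤ) + 1) * c ^ k := le_of_mul_le_mul_left h3 (by exact_mod_cast hb)
      exact_mod_cast h4
    calc rad (a ^ (k + 1)) (c ^ (k + 1) - a ^ (k + 1)) (c ^ (k + 1))
        = radical (a ^ (k + 1) * (c ^ (k + 1) - a ^ (k + 1)) * c ^ (k + 1)) := rad_def _ _ _
      _ ≤ radical (a ^ (k + 1)) * radical (c ^ (k + 1) - a ^ (k + 1)) * radical (c ^ (k + 1)) :=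
          (radical_mul_le _ _).trans (Nat.mul_le_mul_right _ (radical_mul_le _ _))
      _ = radical a * radical (b * G) * radical c := by rw [radical_pow _ hN0, radical_pow _ hN0, hG]
      _ ≤ radical a * (radical b * G) * radical c :=
          Nat.mul_le_mul_right _ (Nat.mul_le_mul_left _ (radical_mul_le_mul_self _ hG0))
      _ = rad a b c * G := by rw [rad_eq_prod ⟨ha, hb, habc, hcop⟩]; ring
      _ ≤ rad a b c * ((k + 1) * c ^ k) := Nat.mul_le_mul_left _ hGle
      _ = (k + 1) * rad a b c * c ^ k := by ring

/-- the receiving class of the power lift -/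
def QPow (k : ℕ) (a b c : ℕ) : Prop := HypType a b c ∨ EucShape a b c ∨ PowCell (k + 1) a b c

/-- **DELOCALISATION**: for every `N = k+1 ≥ 1`, `P_H → P_E → abc|PowCell N → ABC`. -/
theorem deloc (k : ℕ) (hH : CampanaHyperbolicBound) (hE : EuclideanABC)
    (hP : AbcOn (PowCell (k + 1))) : _root_.ABC := by
  have hQ : AbcOn (QPow k) := abcOn_or (abcOn_hyp_of_bound hH) (abcOn_or (euclideanABC_iff.mp hE) hP)
  refine abc_of_transport hQ (k := k) (A := 1) (K := k + 1) one_pos (Nat.succ_pos k) fun a b c ht => ?_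
  obtain ⟨a', b', c', ht', ⟨hA, hC⟩, hc', hr'⟩ := pow_transport k ht
  refine ⟨a', b', c', ht', ?_, hc', hr'⟩
  rcases hyp_or_euc_or_sph a' b' c' with h | h | h
  · exact Or.inl h
  · exact Or.inr (Or.inl h)
  · exact Or.inr (Or.inr ⟨h, hA, hC⟩)

/-- Delocalisation, iff form: given `P_H, P_E`, `ABC ↔ AbcOn (PowCell (k+1))` for every `k`. -/
theorem deloc_iff (k : ℕ) (hH : CampanaHyperbolicBound) (hE : EuclideanABC) :
    _root_.ABC ↔ AbcOn (PowCell (k + 1)) :=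
  ⟨fun h => abcOn_of_abc h _, deloc k hH hE⟩

/-- the supports are nested … -/
theorem powCell_nested {k a b c : ℕ} (h : PowCell (k + 2) a b c) : PowCell (k + 1) a b c :=
  ⟨h.1, adm_mono h.2.1 (by omega) (by omega), adm_mono h.2.2 (by omega) (by omega)⟩

/-- … and EVANESCENT: no abc triple lies in all of them. -/
theorem powCell_evanescent {a b c : ℕ} (ht : IsABCTriple a b c) : ∃ k : ℕ, ¬ PowCell (k + 1) a b c := by
  obtain ⟨ha0, hb0, hc0, hac, hbc⟩ := triple_facts ht
  have hc1 : c ≠ 1 := by omega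
  obtain ⟨ℓ, hℓ, hℓc⟩ := Nat.exists_prime_and_dvd hc1
  refine ⟨c.factorization ℓ, fun h => ?_⟩
  have := h.2.2.2 ℓ (Nat.mem_primeFactors.2 ⟨hℓ, hℓc, hc0⟩)
  omega

end Summit.ABC.ABC.Theorems.PlatonicClosureCore
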